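import Summits.Ventures.PercRepro.C026SuperAdd
import Summits.Ventures.PercRepro.C026GluingG2

/-!
# C-028(c): the covariance of `A = {a ↔ b}` and `B = {c ↔ {a, b}}` against `√(Y_a Y_b)` (p6, gen 15;
mine-3 MINE3-GLUING §1)

With the rows `x = P(abc)`, `y₁ = P(ab|c)`, `y₂ = Y_a = P(ac|b)`, `y₃ = Y_b = P(bc|a)`:
`Cov(1_A, 1_B) = x − (x + y₁)(x + y₂ + y₃)` (`c028Cov`) and `P(B)·P(Aᶜ) = (y₂ + y₃) + Cov`
(`prob_mul_eq_add_cov`).  ROW C-028(c) is `Cov ≤ √(Y_a Y_b)` (`C028At`, a statement; the forest-class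
theorem of mine-3 proves it on every `G` with `G − a − b` a forest via LEMMA G2, `C026GluingG2`).  By
AM–GM, `√(Y_a Y_b) ≤ (Y_a + Y_b)/2`, and `Cov ≤ (Y_a + Y_b)/2` is exactly the `2/3`-slack being
nonnegative: **C-028 ⟹ C-035 ⟹ C-026** (`slackGamma_twoThirds_nonneg_of_C028At`, `C026At_of_C028At`).
-/

namespace PercRepro

/-- **The rows against `Φ`** (mine-3 §2 (d)): with `d = Z − K(Ma + Mb − Z)`, for `0 < Z ≤ Ma, Mb`,
`d ≤ √((Ma − Z)(Mb − Z)) ↔ (Z/Ma · Z/Mb − √(Z/Ma · Z/Mb · (1 − Z/Ma) · (1 − Z/Mb))) / (Z/Ma + Z/Mb − Z/Ma · Z/Mb) ≤ K`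
— i.e. C-028(c) reads `K ≥ Φ(Z/Mₐ, Z/M_b)`. -/
theorem c028_rows_iff_phi {Z Ma Mb K : ℝ} (hZ : 0 < Z) (hMa : Z ≤ Ma) (hMb : Z ≤ Mb) :
    Z - K * (Ma + Mb - Z) ≤ Real.sqrt ((Ma - Z) * (Mb - Z)) ↔
      (Z / Ma * (Z / Mb) - Real.sqrt (Z / Ma * (Z / Mb) * (1 - Z / Ma) * (1 - Z / Mb))) /
        (Z / Ma + Z / Mb - Z / Ma * (Z / Mb)) ≤ K := by
  have hMa0 : 0 < Ma := lt_of_lt_of_le hZ hMa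
  have hMb0 : 0 < Mb := lt_of_lt_of_le hZ hMb
  -- √(x y (1−x)(1−y)) = √((Ma−Z)(Mb−Z)) · Z/(Ma Mb)
  have hsq : Real.sqrt (Z / Ma * (Z / Mb) * (1 - Z / Ma) * (1 - Z / Mb)) =
      Real.sqrt ((Ma - Z) * (Mb - Z)) * (Z / (Ma * Mb)) := by
    have harg : Z / Ma * (Z / Mb) * (1 - Z / Ma) * (1 - Z / Mb) =
        ((Ma - Z) * (Mb - Z)) * (Z / (Ma * Mb)) ^ 2 := by
      field_simp
    rw [harg, Real.sqrt_mul (mul_nonneg (by linarith) (by linarith)), Real.sqrt_sq (by positivity)]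
  have hden : 0 < Z / Ma + Z / Mb - Z / Ma * (Z / Mb) := by
    have h1 : Z / Ma ≤ 1 := by rw [div_le_one hMa0]; exact hMa
    have h2 : 0 < Z / Mb := div_pos hZ hMb0
    have h3 : 0 < Z / Ma := div_pos hZ hMa0
    nlinarith [mul_pos h3 h2]
  rw [hsq, div_le_iff₀ hden]
  constructor
  · intro h
    -- multiply the row form by Z/(Ma Mb) > 0
    have hk : 0 < Z / (Ma * Mb) := div_pos hZ (mul_pos hMa0 hMb0)
    have := mul_le_mul_of_nonneg_right h hk.le
    have e1 : (Z - K * (Ma + Mb - Z)) * (Z / (Ma * Mb)) =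
        Z / Ma * (Z / Mb) - K * (Z / Ma + Z / Mb - Z / Ma * (Z / Mb)) := by
      field_simp
      ring
    rw [e1] at this
    linarith
  · intro h
    have hk : 0 < Z / (Ma * Mb) := div_pos hZ (mul_pos hMa0 hMb0)
    have e1 : (Z - K * (Ma + Mb - Z)) * (Z / (Ma * Mb)) =
        Z / Ma * (Z / Mb) - K * (Z / Ma + Z / Mb - Z / Ma * (Z / Mb)) := by
      field_simp
      ring
    have h2 : (Z - K * (Ma + Mb - Z)) * (Z / (Ma * Mb)) ≤
        Real.sqrt ((Ma - Z) * (Mb - Z)) * (Z / (Ma * Mb)) := by rw [e1]; linarith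
    exact le_of_mul_le_mul_right h2 hk


namespace MultiGraph

variable {V E : Type*} (G : MultiGraph V E) [Fintype E] [DecidableEq E]

/-- **The C-028 defect** `d = Cov(1_A, 1_B) = P(A ∩ B) − P(A)·P(B)` in the rows:
`x − (x + y₁)(x + y₂ + y₃)`. -/
noncomputable def c028Cov (p : E → ℝ) (a b c : V) : ℝ :=
  G.law3 p a b c 0 - (G.law3 p a b c 0 + G.law3 p a b c 1) *
    (G.law3 p a b c 0 + G.law3 p a b c 2 + G.law3 p a b c 3)

/-- **ROW C-028(c)** (mine-3 g36, a statement): `Cov(1_A, 1_B) ≤ √(Y_a · Y_b)`. -/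
def C028At (p : E → ℝ) (a b c : V) : Prop :=
  G.c028Cov p a b c ≤ Real.sqrt (G.law3 p a b c 2 * G.law3 p a b c 3)

/-- `P(B)·P(Aᶜ) = (y₂ + y₃) + Cov` (on the simplex). -/
theorem prob_mul_eq_add_cov (p : E → ℝ) (a b c : V) :
    (G.law3 p a b c 0 + G.law3 p a b c 2 + G.law3 p a b c 3) *
        (G.law3 p a b c 2 + G.law3 p a b c 3 + G.law3 p a b c 4) =
      (G.law3 p a b c 2 + G.law3 p a b c 3) + G.c028Cov p a b c := by
  have h := law3_sum_eq_one G p a b c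
  unfold c028Cov
  linear_combination (G.law3 p a b c 0 + G.law3 p a b c 2 + G.law3 p a b c 3) * h

/-- The `2/3`-slack is `(Y − 2·Cov)/3` with `Y = y₂ + y₃`. -/
theorem slackGamma_twoThirds_eq (p : E → ℝ) (a b c : V) :
    G.slackGamma (2 / 3) p a b c =
      ((G.law3 p a b c 2 + G.law3 p a b c 3) - 2 * G.c028Cov p a b c) / 3 := by
  unfold slackGamma
  rw [G.prob_mul_eq_add_cov]
  ring

/-- **C-028 ⟹ C-035** (AM–GM): `Cov ≤ √(Y_a Y_b) ≤ (Y_a + Y_b)/2` gives `s_{2/3} ≥ 0`, i.e.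
`P(B ∧ Aᶜ) ≥ (2/3)·P(B)·P(Aᶜ)`. -/
theorem slackGamma_twoThirds_nonneg_of_C028At {p : E → ℝ} (hp : IsProb p) {a b c : V}
    (h : G.C028At p a b c) : 0 ≤ G.slackGamma (2 / 3) p a b c := by
  rw [G.slackGamma_twoThirds_eq]
  have hy2 : 0 ≤ G.law3 p a b c 2 := prob_nonneg hp _
  have hy3 : 0 ≤ G.law3 p a b c 3 := prob_nonneg hp _
  have hamgm : Real.sqrt (G.law3 p a b c 2 * G.law3 p a b c 3) ≤
      (G.law3 p a b c 2 + G.law3 p a b c 3) / 2 := by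
    rw [Real.sqrt_le_left]
    · nlinarith [sq_nonneg (G.law3 p a b c 2 - G.law3 p a b c 3)]
    · linarith
  unfold C028At at h
  have : 2 * G.c028Cov p a b c ≤ G.law3 p a b c 2 + G.law3 p a b c 3 := by linarith
  linarith

/-- **C-028 ⟹ C-026**. -/
theorem C026At_of_C028At {V E : Type} (G : MultiGraph V E) [Fintype E] [DecidableEq E]
    {p : E → ℝ} (hp : IsProb p) {a b c : V} (h : G.C028At p a b c) : G.C026At p a b c := by
  rw [G.C026At_iff_slack26_nonneg, G.slack26_eq_two_mul_slackGamma_half]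
  have h23 := G.slackGamma_twoThirds_nonneg_of_C028At hp h
  have hB := prob_nonneg hp (G.connEvent c a ∪ G.connEvent c b)
  have hA := prob_nonneg hp (G.sepEvent a b)
  rw [slackGamma_eq_prob] at h23 ⊢
  nlinarith [mul_nonneg hB hA]

/-- `c028Cov` in the coordinates `Z = P(a|b|c)`, `Mₐ = P(b iso) = y₂ + z`, `M_b = P(a iso) = y₃ + z`,
`K = P(c iso) = y₁ + z`: `d = Z − K(Mₐ + M_b − Z)` (on the simplex). -/
theorem c028Cov_eq_state (p : E → ℝ) (a b c : V) :
    G.c028Cov p a b c =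
      G.law3 p a b c 4 - (G.law3 p a b c 1 + G.law3 p a b c 4) *
        ((G.law3 p a b c 2 + G.law3 p a b c 4) + (G.law3 p a b c 3 + G.law3 p a b c 4) -
          G.law3 p a b c 4) := by
  have h := law3_sum_eq_one G p a b c
  unfold c028Cov
  linear_combination (G.law3 p a b c 4 - G.law3 p a b c 0) * h

/-- **C-028(c) is `K ≥ Φ(Z/Mₐ, Z/M_b)`** (when `Z = P(a|b|c) > 0`): the form in which LEMMA G2
(`C026GluingG2`) propagates it through a gluing. -/
theorem C028At_iff_phi {p : E → ℝ} (hp : IsProb p) {a b c : V} (hZ : 0 < G.law3 p a b c 4) :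
    G.C028At p a b c ↔
      c028Phi (G.law3 p a b c 4 / (G.law3 p a b c 2 + G.law3 p a b c 4))
          (G.law3 p a b c 4 / (G.law3 p a b c 3 + G.law3 p a b c 4)) ≤
        G.law3 p a b c 1 + G.law3 p a b c 4 := by
  have hy2 : 0 ≤ G.law3 p a b c 2 := prob_nonneg hp _
  have hy3 : 0 ≤ G.law3 p a b c 3 := prob_nonneg hp _
  unfold C028At c028Phi
  rw [G.c028Cov_eq_state]
  have hsq : G.law3 p a b c 2 * G.law3 p a b c 3 =
      ((G.law3 p a b c 2 + G.law3 p a b c 4) - G.law3 p a b c 4) *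
        ((G.law3 p a b c 3 + G.law3 p a b c 4) - G.law3 p a b c 4) := by ring
  rw [hsq]
  exact c028_rows_iff_phi hZ (by linarith) (by linarith)

/-! ### The degenerate cases: a deterministic `A = {a ↔ b}` or an unreachable probe -/

/-- If the probe reaches no mark (`P(B) = 0`, e.g. `c` isolated) the defect is `0`. -/
theorem C028At_of_prob_B_eq_zero {p : E → ℝ} (hp : IsProb p) {a b c : V}
    (h : prob p (G.connEvent c a ∪ G.connEvent c b) = 0) : G.C028At p a b c := by
  have hB := G.law3_zero_add_two_add_three p a b c
  have h0 := prob_nonneg hp (G.partitionEvent ![a, b, c] ![0, 0, 0])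
  have h2 := prob_nonneg hp (G.partitionEvent ![a, b, c] ![0, 1, 0])
  have h3 := prob_nonneg hp (G.partitionEvent ![a, b, c] ![0, 1, 1])
  rw [← law3_zero] at h0
  rw [← law3_two] at h2
  rw [← law3_three] at h3
  have hx : G.law3 p a b c 0 = 0 := by linarith
  have hy2 : G.law3 p a b c 2 = 0 := by linarith
  have hy3 : G.law3 p a b c 3 = 0 := by linarith
  unfold C028At c028Cov
  rw [hx, hy2, hy3]
  simp

/-- If `a ↔ b` is impossible (`P(A) = 0`, e.g. `a` or `b` isolated) the defect is `0`. -/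
theorem C028At_of_prob_A_eq_zero {p : E → ℝ} (hp : IsProb p) {a b c : V}
    (h : prob p (G.connEvent a b) = 0) : G.C028At p a b c := by
  have hA := G.law3_zero_add_one p a b c
  have h0 := prob_nonneg hp (G.partitionEvent ![a, b, c] ![0, 0, 0])
  have h1 := prob_nonneg hp (G.partitionEvent ![a, b, c] ![0, 0, 1])
  rw [← law3_zero] at h0
  rw [← law3_one] at h1
  have hx : G.law3 p a b c 0 = 0 := by linarith
  have hy1 : G.law3 p a b c 1 = 0 := by linarith
  unfold C028At c028Cov
  rw [hx, hy1]
  have : (0 : ℝ) - (0 + 0) * (0 + G.law3 p a b c 2 + G.law3 p a b c 3) = 0 := by ring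
  rw [this]
  exact Real.sqrt_nonneg _

/-- If `a ↔ b` is sure (`P(A) = 1`) the defect is `0`. -/
theorem C028At_of_prob_A_eq_one {p : E → ℝ} (hp : IsProb p) {a b c : V}
    (h : prob p (G.connEvent a b) = 1) : G.C028At p a b c := by
  have hA := G.law3_zero_add_one p a b c
  have hAc := G.law3_two_add_three_add_four p a b c
  have hs : prob p (G.sepEvent a b) = 1 - prob p (G.connEvent a b) := prob_compl _ _
  have h2 := prob_nonneg hp (G.partitionEvent ![a, b, c] ![0, 1, 0])
  have h3 := prob_nonneg hp (G.partitionEvent ![a, b, c] ![0, 1, 1])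
  have h4 := prob_nonneg hp (G.partitionEvent ![a, b, c] ![0, 1, 2])
  rw [← law3_two] at h2
  rw [← law3_three] at h3
  rw [← law3_four] at h4
  have hy2 : G.law3 p a b c 2 = 0 := by linarith
  have hy3 : G.law3 p a b c 3 = 0 := by linarith
  unfold C028At c028Cov
  rw [hy2, hy3, hA, h]
  have : G.law3 p a b c 0 - 1 * (G.law3 p a b c 0 + 0 + 0) = 0 := by ring
  rw [this, mul_zero, Real.sqrt_zero]

end MultiGraph

end PercRepro
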